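import Literature.NumberTheory.EllipticCurves.Castella2018.ErratumThm23UpperDivisibility
import Summits.BirchSwinnertonDyer.BirchSwinnertonDyer.Theorems.ErratumRoadFiveTwoVariableCharIdealDescent
import Literature.NumberTheory.EllipticCurves.IwasawaCyclotomicProofs
import HarnessLib

/-!
# Crux `ErratumThm23SigmaLe` (stmt-BirchSwinnertonDyer-25505, F4♯) from the TWO-VARIABLE main-conjecture
# package over the `ℤ_p²`-extension — the erratum's own chain «[FW21, Thm. 4.41] ⇒ (2.4) ⇒ (2.5)» with the
# algebra of [JSW17, Cor. 3.4.2] DISCHARGED in the kernel (helper, `--supports stmt-BirchSwinnertonDyer-25505`)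

Cell `bsd-stepL`, seat `bsd-stepL-imc-p1` (prover g20, 2026-08-28). Theorems only (no definition, no
named fact, no `sorry`, no instance, no notation).

## What this file proves

Castella's erratum proves its Thm. 2.3 «⊂» (the tree's OPEN input F4♯ =
`Castella2018.erratumThm23_charIdeal_sigma_le_of_isTorsion_OPEN`, crux 25505 of route ErratumRoadFive)
in three printed steps (erratum p. 4): (2.4) the TWO-VARIABLE divisibility
`Ch_{Λ̃_𝒪}(X_K(A_g))Λ̃_𝒪^ur ⊂ (L^Gr_p(g))` over the `ℤ_p²`-extension `K_∞/K` «by [FW21, Thm. 4.41]»;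
the identification of the restriction of `L^{Gr,Σ}_p(g)` to the anticyclotomic line with `L^Σ_p(g)` up
to a unit «by [FO12, Cor. 7.2.1] … the same calculation as in [CGS23, Prop. 1.4.5]»; and the descent
«by [JSW17, Cor. 3.4.2] it follows that (2.4) yields (2.5)». [JSW17, §3.4] (held text arXiv:1512.06894
p. 14): "`Γ_K = Gal(K_∞/K) ≅ ℤ_p²` … `Λ_K = 𝒪⟦Γ_K⟧` … `𝓜 = T ⊗_𝒪 Λ_K^*` with `G_K`-action
`ρ ⊗ Ψ_K⁻¹` … We have `M = 𝓜[γ₊ − 1]` and, by (irr_K), `H¹(K^S/K, M) ≅ H¹(K^S/K, 𝓜)[γ₊ − 1]`, which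
induces maps `H¹_{ac^Σ}(K, M) ↪ H¹_{Gr^Σ}(K, 𝓜)[γ₊ − 1]` and
`X^Σ_Gr(𝓜)/(γ₊ − 1)X^Σ_Gr(𝓜) → X^Σ_ac(M)`. **Lemma 3.4.1.** Suppose `Σ` contains all the finite places
`w ∤ p` at which `V` is ramified. Then [these maps] have finite cokernel and kernel, respectively.
**Corollary 3.4.2.** … `chr(X^Σ_ac(M)) ⊂ chr(X^Σ_Gr(𝓜)) mod (γ₊ − 1)`."

THE OBJECT (no new definition): in the tree's co-induced model (`AnticyclotomicBigGaloisRep`,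
`BigRepModule` = smooth `p`-primary maps `ℤ_p → A`) the two-variable big representation
`𝓜 = T_g ⊗ Λ_K^*(Ψ_K⁻¹)` over `Λ_K = 𝒪⟦T_a⟧⟦T_c⟧ = PowerSeries (PowerSeries 𝒪)` IS the ITERATE
`AnticyclotomicBigGaloisRep κc (AnticyclotomicBigGaloisRep κa ρ)` (smooth maps `ℤ_p → (ℤ_p → A) =
ℤ_p² → A`, `G_K` acting by `ρ ⊗ Ψ_K⁻¹`, `κc`/`κa` the cyclotomic/anticyclotomic `ℤ_p`-extensions), and
its `Σ`-imprimitive Selmer dual with characteristic ideal is `XBig κc (AnticyclotomicBigGaloisRep κa ρ) 𝔮 S`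
/ `XBig.charIdeal …` — a `PowerSeries (PowerSeries 𝒪)`-module whose OUTER variable is
`T_c = γ_c − 1`, so that JSW's «mod (γ₊ − 1)» is `PowerSeries.constantCoeff` (`T_c ↦ 0`), the exact
shape of the tree's PROVED specialisation algebra.

The ALGEBRA ([JSW17, Cor. 3.4.2] in `Module.charIdeal` currency: `ch_{Λ_a}(Y) ⊆ ch_{Λ_K}(N)(T_c = 0)` for
a control surjection `N/T_cN ↠ Y` with pseudo-null kernel onto a torsion `Y`; factoriality of
`𝒪⟦T_a⟧⟦T_c⟧`) is the companion file `ErratumRoadFiveTwoVariableCharIdealDescent.lean`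
(`TwoVariableDescent.*`, `CoeffRing.*`). Here:

* §1 (the reduction AT the data, PROVED): `AtData.map_charIdeal_le_span_of_twoVariable_of_control` — AT the data of F4♯, its
  conclusion `Ch_{Λ_𝒪}(X^Σ_ac(A_g))·𝓞_{ℂ_p}⟦T⟧ ⊆ (Q)` follows from
  (S3, [JSW17, Lemma 3.4.1] + «finite `Λ_K`-module» §3.4 — kernel-provable later from the tree's
  `TorsionControl.selmerTorsionEquiv` at `r = T_c` with `BigRepModule.shiftSubOne_surjective`,
  `bigRep_invariants_eq_bot`): `X^Σ(𝓜)` is finitely generated over `Λ_K` and there is a surjective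
  `Λ_a`-linear map `X^Σ(𝓜)/T_c ↠ X^Σ_ac(M)` with pseudo-null kernel; and
  (S12, OPEN = [FW21, Thm. 4.41] + [FW21, App. B Cor. 7.21 / Lemma 7.22] + the weight-`k` [CGS25,
  Prop. 2.4.5]-type computation, exactly as the erratum invokes them): if `X^Σ(𝓜)` is `Λ_K`-torsion
  then for some `𝓛₂ ∈ 𝓞_{ℂ_p}⟦T_a⟧⟦T_c⟧` dividing `Ch_{Λ_K}(X^Σ(𝓜))` (read in `𝓞_{ℂ_p}`) one has
  `𝓛₂(T_c = 0) = u · Q` with `u` a unit, for the BDP Σ-frame `Q` of F4♯;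
  the two-variable TORSION premise of S12 is DISCHARGED here from F4♯'s own one-variable torsion
  premise + S3 (determinant trick, `exists_constantCoeff_ne_zero_smul_eq_zero`).
* §2: `OfControl.stub_JSW_sigmaDescent_of_control` — the REGISTERED stub `stub_JSW_sigmaDescent` (S2) of the
  line `Cruxes/ErratumThm23SigmaLe/Lines/erratum_chain.lean` (seat bsd-idea-9, lens `complete`; found
  independently and concurrently — same iterated object) VERBATIM, from the CONTROL statement alone
  ([JSW17, §3.4 + Lemma 3.4.1], for every cyclotomic `κ'`): S2's «Fitt ⊆ Ch, Fitting base change, principal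
  hull, torsion transfer, existence of the cyclotomic κ'» are all discharged here, so along that line S2
  SHRINKS to control (a reshaped skeleton `erratum_chain` v2 with `stub_control` in place of S2 is delivered to
  the planner as evidence; here the control statement is a DISPLAYED hypothesis, not a named fact).
  `maxHeartbeats` is raised on the two data-level declarations: their STATEMENTS (iterated big representation,
  two `letI` module structures, F4♯'s binder list up to three times) cost more than the default budget to
  elaborate; the proofs are a handful of `exact`s.

HONEST FRAMING: conditional bookkeeping; S12 is OPEN (unrefereed [FW21]); nothing about any newform or
curve is asserted; BSD is proved for no pair; closes: none (T7). The value is that the OPEN input of K2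
is now keyed, in the kernel, to the TWO-VARIABLE Selmer object of [FW21]/[JSW17 §3.4] with the
descent algebra proved, leaving [JSW17, Lemma 3.4.1] (S3) as kernel-provable work.

## References

* [Castella2018Erratum] F. Castella, Erratum to "On the p-part of the Birch–Swinnerton-Dyer formula
  for multiplicative primes", §2, Thm. 2.3, (2.4)–(2.5) (p. 4).
* [JetchevSkinnerWan2017] D. Jetchev, C. Skinner, X. Wan, Camb. J. Math. 5 (2017), §3.4, Lemma 3.4.1,
  Cor. 3.4.2 (arXiv:1512.06894 p. 14).
* [FouquetWan2021] O. Fouquet, X. Wan, arXiv:2107.13726, Thm. 4.41, App. B Cor. 7.21, Lemma 7.22.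
* [CastellaGrossiSkinner2025] Math. Ann. (2025), Prop. 2.4.5. [SkinnerUrban2014] Invent. Math. 195,
  §3.1.6, Cor. 3.2.9 (ii). [Bourbaki AC VII §4.4–4.5].
-/

noncomputable section

open Function
open scoped Classical Pointwise

-- D-0017: single-problem summit, the namespace repeats the problem name by design.
set_option linter.dupNamespace false
set_option autoImplicit false

namespace Summit.BirchSwinnertonDyer.BirchSwinnertonDyer.Theorems.ErratumThm23TwoVariable

open Literature.NumberTheory.EllipticCurves Literature.NumberTheory.EllipticCurves.Module

/-! ## §1 The reduction AT the data of F4♯: the one-variable divisibility from two-variable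
divisibility + restriction (S12, OPEN) and control (S3) -/

namespace AtData

open Literature.NumberTheory.EllipticCurves.ModularForms Literature.NumberTheory.EllipticCurves.BigGaloisRep
  Literature.NumberTheory.EllipticCurves.GreenbergSelmer Literature.NumberTheory.GaloisRepresentations
  NumberField IsDedekindDomain Field TwoVariableDescent

variable {p : ℕ} [Fact p.Prime] {M : ℕ} [NeZero M] {k : ℤ}
  {g : CuspForm (CongruenceSubgroup.Gamma0 M) k} {ιg : coeffField g →+* PadicAlgCl p}
  (Δ : OrdinaryNewformDatum g p ιg)
  {K : Type} [Field K] [NumberField K] (𝔮 : HeightOneSpectrum (𝓞 K)) (κc κa : ZpExtension K p)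
  (S : Finset (HeightOneSpectrum (𝓞 K)))
  [TopologicalSpace (PowerSeries (padicCoeffIntegers ιg))]
  [ContinuousSMul (PowerSeries (padicCoeffIntegers ιg))
    (BigRepModule (padicCoeffIntegers ιg) p (Cofree Δ.ρ (padicCoeffField ιg)))]
  [TopologicalSpace (PowerSeries (PowerSeries (padicCoeffIntegers ιg)))]
  [ContinuousSMul (PowerSeries (PowerSeries (padicCoeffIntegers ιg)))
    (BigRepModule (PowerSeries (padicCoeffIntegers ιg)) p
      (BigRepModule (padicCoeffIntegers ιg) p (Cofree Δ.ρ (padicCoeffField ιg))))]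

set_option maxHeartbeats 400000 in
-- the STATEMENT alone (iterated big representation, two `letI` module structures) costs most of the
-- default budget; the proof is a handful of `exact`s
/-- **F4♯'s conclusion at its data, from the two-variable package.** For a newform `g` with
coefficient ring `𝒪 = padicCoeffIntegers ι_g`, datum `Δ`, a number field `K`, a prime `𝔮`, `Σ = S`, the
anticyclotomic (`κa`) and a second (`κc`, cyclotomic) `ℤ_p`-extension, let
`N = X^Σ(𝓜) := XBig κc (AnticyclotomicBigGaloisRep κa (Δ.cofreeRepOver K)) 𝔮 S` be the Σ-imprimitive
Selmer dual of the TWO-VARIABLE big representation over `Λ_K = 𝒪⟦T_a⟧⟦T_c⟧` and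
`Y = X^Σ_ac(M) := XBig κa (Δ.cofreeRepOver K) 𝔮 S` the one-variable one over `Λ_a = 𝒪⟦T_a⟧`. ASSUME
(S3 = [JSW17, §3.4 "a finite `Λ_K`-module" + Lemma 3.4.1]) `N` finitely generated and a surjective
`Λ_a`-linear control map `f : N/T_cN → Y` (constants structure) with pseudo-null kernel; and
(S12 = [FW21, Thm. 4.41] ⇒ (2.4), Σ-imprimitive, + [FW21, App. B Cor. 7.21 / Lemma 7.22] + the
[CGS25, Prop. 2.4.5]-type restriction, as the erratum invokes them) that IF `N` is `Λ_K`-torsion THEN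
some `𝓛₂ ∈ 𝓞_{ℂ_p}⟦T_a⟧⟦T_c⟧` contains `Ch_{Λ_K}(N)·𝓞_{ℂ_p}⟦T_a⟧⟦T_c⟧` and restricts to `u · Q`,
`u` a unit. THEN F4♯'s torsion premise on `Y` gives its conclusion
`Ch_{Λ_a}(Y)·𝓞_{ℂ_p}⟦T_a⟧ ⊆ (Q)`. The two-variable torsion is DERIVED (not assumed): `N/T_cN` is
pseudo-isomorphic to the torsion `Y`, so a `s` with `s(0) ≠ 0` kills `N`. Ring-theoretic clauses
(`𝒪` a PID, `Λ_K` factorial) are discharged for the NEWFORM `g` (§2).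
[cite: Castella2018Erratum, §2 proof of Thm. 2.3, (2.4) ⇒ (2.5) (p. 4)]
[cite: JetchevSkinnerWan2017, §3.4, Lemma 3.4.1 and Cor. 3.4.2 (arXiv:1512.06894 p. 14)] -/
theorem map_charIdeal_le_span_of_twoVariable_of_control (hnf : IsNewform0 g)
    (b : padicCoeffIntegers ιg →+* PadicComplexInt p) (Q : PowerSeries (PadicComplexInt p))
    [Module.Finite (PowerSeries (PowerSeries (padicCoeffIntegers ιg)))
      (XBig κc (AnticyclotomicBigGaloisRep κa (Δ.cofreeRepOver K)) 𝔮 (↑S))]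
    (f : letI : _root_.Module (PowerSeries (padicCoeffIntegers ιg))
              (QuotSMulTop (PowerSeries.X : PowerSeries (PowerSeries (padicCoeffIntegers ιg)))
                (XBig κc (AnticyclotomicBigGaloisRep κa (Δ.cofreeRepOver K)) 𝔮 (↑S))) :=
            Module.compHom _ (PowerSeries.C (R := PowerSeries (padicCoeffIntegers ιg)))
      QuotSMulTop (PowerSeries.X : PowerSeries (PowerSeries (padicCoeffIntegers ιg)))
          (XBig κc (AnticyclotomicBigGaloisRep κa (Δ.cofreeRepOver K)) 𝔮 (↑S))
        →ₗ[PowerSeries (padicCoeffIntegers ιg)] XBig κa (Δ.cofreeRepOver K) 𝔮 (↑S))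
    (hf : Surjective f)
    (hker : letI : _root_.Module (PowerSeries (padicCoeffIntegers ιg))
              (QuotSMulTop (PowerSeries.X : PowerSeries (PowerSeries (padicCoeffIntegers ιg)))
                (XBig κc (AnticyclotomicBigGaloisRep κa (Δ.cofreeRepOver K)) 𝔮 (↑S))) :=
            Module.compHom _ (PowerSeries.C (R := PowerSeries (padicCoeffIntegers ιg)))
      IsPseudoNull (PowerSeries (padicCoeffIntegers ιg)) (LinearMap.ker f))
    (h12 : Module.IsTorsion (PowerSeries (PowerSeries (padicCoeffIntegers ιg)))
        (XBig κc (AnticyclotomicBigGaloisRep κa (Δ.cofreeRepOver K)) 𝔮 (↑S)) →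
      ∃ L₂ : PowerSeries (PowerSeries (PadicComplexInt p)),
        (XBig.charIdeal κc (AnticyclotomicBigGaloisRep κa (Δ.cofreeRepOver K)) 𝔮 (↑S)).map
            (PowerSeries.map (PowerSeries.map b)) ≤ Ideal.span {L₂} ∧
          ∃ u : (PowerSeries (PadicComplexInt p))ˣ,
            PowerSeries.constantCoeff L₂ = (u : PowerSeries (PadicComplexInt p)) * Q)
    (hT : Module.IsTorsion (PowerSeries (padicCoeffIntegers ιg)) (XBig κa (Δ.cofreeRepOver K) 𝔮 (↑S))) :
    (XBig.charIdeal κa (Δ.cofreeRepOver K) 𝔮 (↑S)).map (PowerSeries.map b) ≤ Ideal.span {Q} := by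
  -- ring-theoretic clauses for the newform's coefficient ring
  haveI := CoeffRing.finiteDimensional_padicCoeffField ιg hnf
  haveI : IsPrincipalIdealRing (padicCoeffIntegers ιg) := CoeffRing.isPrincipalIdealRing ιg
  haveI : UniqueFactorizationMonoid (PowerSeries (PowerSeries (padicCoeffIntegers ιg))) :=
    CoeffRing.uniqueFactorizationMonoid_powerSeries_powerSeries ιg
  -- two-variable torsion from one-variable torsion + control
  have hs := exists_constantCoeff_ne_zero_of_control
    (A := PowerSeries (padicCoeffIntegers ιg))
    (XBig κc (AnticyclotomicBigGaloisRep κa (Δ.cofreeRepOver K)) 𝔮 (↑S))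
    (XBig κa (Δ.cofreeRepOver K) 𝔮 (↑S)) hT f hker
  have htors₂ := isTorsion_of_exists_constantCoeff_ne_zero
    (A := PowerSeries (padicCoeffIntegers ιg))
    (XBig κc (AnticyclotomicBigGaloisRep κa (Δ.cofreeRepOver K)) 𝔮 (↑S)) hs
  obtain ⟨L₂, hL₂, u, hu⟩ := h12 htors₂
  -- descent of the characteristic ideal along `T_c ↦ 0` (JSW Cor. 3.4.2, kernel form)
  have hdesc := charIdeal_le_map_constantCoeff_of_control
    (A := PowerSeries (padicCoeffIntegers ιg))
    (XBig κc (AnticyclotomicBigGaloisRep κa (Δ.cofreeRepOver K)) 𝔮 (↑S))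
    (XBig κa (Δ.cofreeRepOver K) 𝔮 (↑S)) hT f hf hker
  -- read in `𝓞_{ℂ_p}` and compare with the frame
  refine (Ideal.map_mono hdesc).trans ?_
  rw [map_map_constantCoeff_eq b]
  exact map_constantCoeff_le_span_of_le_span_of_eq_unit_mul hL₂ hu

end AtData

/-! ## §2 The REGISTERED descent stub `stub_JSW_sigmaDescent` of line `erratum_chain` (crux 25505, seat bsd-idea-9)
from a CONTROL statement ([JSW17, Lemma 3.4.1] + «a finite `Λ_K`-module»): the algebra of [JSW17, Cor. 3.4.2] discharged -/

namespace OfControl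

open Literature.NumberTheory.EllipticCurves.ModularForms Literature.NumberTheory.EllipticCurves.BigGaloisRep
  Literature.NumberTheory.EllipticCurves.GreenbergSelmer Literature.NumberTheory.GaloisRepresentations
  PowerSeries NumberField IsDedekindDomain Field

set_option maxHeartbeats 800000 in
-- statement cost: the registered stub's binder list plus the control hypothesis, both over the iterated big
-- representation (see module docstring); the proof is glue
/-- **The registered stub `stub_JSW_sigmaDescent` (S2 of `Cruxes/ErratumThm23SigmaLe/Lines/erratum_chain.lean`,
VERBATIM as the conclusion) from CONTROL alone.** S2 = «[JSW17, L. 3.4.1] control + `Fitt ⊆ Ch` + Fitting base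
change + "Ch is the smallest principal ideal containing Fitt" [Cor. 3.4.2] + torsion transfer + existence of the
cyclotomic `κ'`»; everything except the CONTROL statement is discharged here: the descent algebra by the companion
file (`TwoVariableDescent.charIdeal_le_map_constantCoeff_of_control`, Herbrand specialisation + pseudo-isomorphism
invariance instead of Fitting ideals), the torsion transfer (`exists_constantCoeff_ne_zero_of_control`), the
cyclotomic `κ'` (`exists_cyclotomicZpExtension_holds`) with a topological generator (`κ'.surjective`), and the
ring-theoretic clauses (§1). The hypothesis `hControl` is S2's binder list (including (HT), the only place JSW use it:
"the argument used in Case 3(b) … to prove that `𝓜^{G_{K_v}}` has finite order", tex p0014) followed by: for every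
CYCLOTOMIC `κ'` with a generator and every admissible pair of topologies, `X^Σ(𝓜)` is finitely generated over `Λ_K`
(JSW §3.4: "a finite `Λ_K`-module") and there is a SURJECTIVE `Λ_a`-linear map `X^Σ(𝓜)/T_c ↠ X^Σ_ac(M_g)` (constants
`Λ_a`-structure) with PSEUDO-NULL kernel (JSW L. 3.4.1: "finite kernel"; finite ⟹ pseudo-null over `Λ_a = 𝒪⟦T⟧`).
CONDITIONAL on that displayed hypothesis (PUBLISHED, kernel-provable from the tree's
`TorsionControl.selmerTorsionEquiv` at `r = T_c`); closes nothing by itself; BSD is proved for no pair.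
[cite: JetchevSkinnerWan2017, §3.4, Lemma 3.4.1 and Cor. 3.4.2 with its proof (arXiv:1512.06894 p. 14–15)]
[cite: Castella2018Erratum, §2, proof of Thm. 2.3: "(2.4) yields the divisibility (2.5)" (p. 4)] -/
theorem stub_JSW_sigmaDescent_of_control
    (hControl :
      ∀ {p : ℕ} [Fact p.Prime] {M : ℕ} [NeZero M] {k : ℤ}
        (g : CuspForm (CongruenceSubgroup.Gamma0 M) k) (ιg : coeffField g →+* PadicAlgCl p)
        (Δ : OrdinaryNewformDatum g p ιg)
        (K : Type) [Field K] [NumberField K] (𝔭bar : HeightOneSpectrum (𝓞 K)) (κ : ZpExtension K p)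
        (γ : absoluteGaloisGroup K) [Fact (κ.IsTopGenerator γ)] (S : Finset (HeightOneSpectrum (𝓞 K))),
        IsNewform0 g → 2 ≤ k → Even k → ¬ p ∣ M → 3 < p →
        ‖ιg ⟨(UpperHalfPlane.qExpansion 1 ⇑g).coeff p, coeff_mem_coeffField g p⟩‖ = 1 →
        IsImaginaryQuadratic K → ((Ideal.span {(p : ℤ)}).primesOver (𝓞 K)).ncard = 2 →
        ((p : ℕ) : 𝓞 K) ∈ 𝔭bar.asIdeal →
        SkinnerUrban2014.IsResiduallyIrreducible Δ →
        (∃ v : HeightOneSpectrum (𝓞 ℚ), SkinnerUrban2014.IsResiduallyRamifiedAt Δ v ∧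
          ((Rat.HeightOneSpectrum.primesEquiv v : Nat.Primes) : ℕ) ∣ M ∧
          ¬ ((Rat.HeightOneSpectrum.primesEquiv v : Nat.Primes) : ℕ) ^ 2 ∣ M ∧
          ((Ideal.span {(((Rat.HeightOneSpectrum.primesEquiv v : Nat.Primes) : ℕ) : ℤ)}).primesOver (𝓞 K)).ncard ≠ 2) →
        κ.IsAnticyclotomic → (∀ w ∈ S, ((p : ℕ) : 𝓞 K) ∉ w.asIdeal) →
        (∀ w : HeightOneSpectrum (𝓞 K), ((M : ℕ) : 𝓞 K) ∈ w.asIdeal → w ∈ S) →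
        -- (HT) of [JSW17 §3.1] for `V_g(1 − k/2)`
        (¬ ((p : ℤ) - 1 ∣ k / 2) ∧ (k = 2 ∨ ¬ ((p : ℤ) - 1 ∣ k / 2 - 1))) →
        -- the complementary CYCLOTOMIC direction `κ'` with a generator `γ'`
        ∀ (κ' : ZpExtension K p) (γ' : absoluteGaloisGroup K) [Fact (κ'.IsTopGenerator γ')], κ'.IsCyclotomic →
        ∀ [TopologicalSpace (PowerSeries (padicCoeffIntegers ιg))]
          [ContinuousSMul (PowerSeries (padicCoeffIntegers ιg))
            (BigRepModule (padicCoeffIntegers ιg) p (Cofree Δ.ρ (padicCoeffField ιg)))]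
          [TopologicalSpace (PowerSeries (PowerSeries (padicCoeffIntegers ιg)))]
          [ContinuousSMul (PowerSeries (PowerSeries (padicCoeffIntegers ιg)))
            (BigRepModule (PowerSeries (padicCoeffIntegers ιg)) p
              (BigRepModule (padicCoeffIntegers ιg) p (Cofree Δ.ρ (padicCoeffField ιg))))],
        -- CONTROL: «X^Σ(𝓜) is a finite Λ_K-module» and «X^Σ(𝓜)/(γ₊ − 1) ↠ X^Σ_ac(M) with finite kernel»
        Module.Finite (PowerSeries (PowerSeries (padicCoeffIntegers ιg)))
            (XBig κ' (AnticyclotomicBigGaloisRep κ (Δ.cofreeRepOver K)) 𝔭bar (↑S)) ∧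
        ∃ f : (letI : _root_.Module (PowerSeries (padicCoeffIntegers ιg))
                  (QuotSMulTop (PowerSeries.X : PowerSeries (PowerSeries (padicCoeffIntegers ιg)))
                    (XBig κ' (AnticyclotomicBigGaloisRep κ (Δ.cofreeRepOver K)) 𝔭bar (↑S))) :=
                Module.compHom _ (PowerSeries.C (R := PowerSeries (padicCoeffIntegers ιg)))
          QuotSMulTop (PowerSeries.X : PowerSeries (PowerSeries (padicCoeffIntegers ιg)))
              (XBig κ' (AnticyclotomicBigGaloisRep κ (Δ.cofreeRepOver K)) 𝔭bar (↑S))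
            →ₗ[PowerSeries (padicCoeffIntegers ιg)] XBig κ (Δ.cofreeRepOver K) 𝔭bar (↑S)),
          Surjective f ∧
          (letI : _root_.Module (PowerSeries (padicCoeffIntegers ιg))
                  (QuotSMulTop (PowerSeries.X : PowerSeries (PowerSeries (padicCoeffIntegers ιg)))
                    (XBig κ' (AnticyclotomicBigGaloisRep κ (Δ.cofreeRepOver K)) 𝔭bar (↑S))) :=
                Module.compHom _ (PowerSeries.C (R := PowerSeries (padicCoeffIntegers ιg)))
          IsPseudoNull (PowerSeries (padicCoeffIntegers ιg)) (LinearMap.ker f))) :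
    -- conclusion: the registered statement `Statement.stub_JSW_sigmaDescent` of line `erratum_chain`, verbatim
    ∀ {p : ℕ} [Fact p.Prime] {M : ℕ} [NeZero M] {k : ℤ}
      (g : CuspForm (CongruenceSubgroup.Gamma0 M) k) (ιg : coeffField g →+* PadicAlgCl p)
      (Δ : OrdinaryNewformDatum g p ιg)
      (K : Type) [Field K] [NumberField K] (𝔭bar : HeightOneSpectrum (𝓞 K)) (κ : ZpExtension K p)
      (γ : absoluteGaloisGroup K) [Fact (κ.IsTopGenerator γ)] (S : Finset (HeightOneSpectrum (𝓞 K))),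
      IsNewform0 g → 2 ≤ k → Even k → ¬ p ∣ M → 3 < p →
      ‖ιg ⟨(UpperHalfPlane.qExpansion 1 ⇑g).coeff p, coeff_mem_coeffField g p⟩‖ = 1 →
      IsImaginaryQuadratic K → ((Ideal.span {(p : ℤ)}).primesOver (𝓞 K)).ncard = 2 →
      ((p : ℕ) : 𝓞 K) ∈ 𝔭bar.asIdeal →
      SkinnerUrban2014.IsResiduallyIrreducible Δ →
      (∃ v : HeightOneSpectrum (𝓞 ℚ), SkinnerUrban2014.IsResiduallyRamifiedAt Δ v ∧
        ((Rat.HeightOneSpectrum.primesEquiv v : Nat.Primes) : ℕ) ∣ M ∧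
        ¬ ((Rat.HeightOneSpectrum.primesEquiv v : Nat.Primes) : ℕ) ^ 2 ∣ M ∧
        ((Ideal.span {(((Rat.HeightOneSpectrum.primesEquiv v : Nat.Primes) : ℕ) : ℤ)}).primesOver (𝓞 K)).ncard ≠ 2) →
      κ.IsAnticyclotomic → (∀ w ∈ S, ((p : ℕ) : 𝓞 K) ∉ w.asIdeal) →
      (∀ w : HeightOneSpectrum (𝓞 K), ((M : ℕ) : 𝓞 K) ∈ w.asIdeal → w ∈ S) →
      (¬ ((p : ℤ) - 1 ∣ k / 2) ∧ (k = 2 ∨ ¬ ((p : ℤ) - 1 ∣ k / 2 - 1))) →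
      ∀ (b : padicCoeffIntegers ιg →+* PadicComplexInt p) (Q : PowerSeries (PadicComplexInt p)),
      ∀ [TopologicalSpace (PowerSeries (padicCoeffIntegers ιg))]
        [ContinuousSMul (PowerSeries (padicCoeffIntegers ιg))
          (BigRepModule (padicCoeffIntegers ιg) p (Cofree Δ.ρ (padicCoeffField ιg)))],
      (∀ (κ' : ZpExtension K p) (γ' : absoluteGaloisGroup K) [Fact (κ'.IsTopGenerator γ')], κ'.IsCyclotomic →
        ∀ [TopologicalSpace (PowerSeries (PowerSeries (padicCoeffIntegers ιg)))]
          [ContinuousSMul (PowerSeries (PowerSeries (padicCoeffIntegers ιg)))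
            (BigRepModule (PowerSeries (padicCoeffIntegers ιg)) p
              (BigRepModule (padicCoeffIntegers ιg) p (Cofree Δ.ρ (padicCoeffField ιg))))],
        Module.IsTorsion (PowerSeries (PowerSeries (padicCoeffIntegers ιg)))
            (XBig κ' (AnticyclotomicBigGaloisRep κ (Δ.cofreeRepOver K)) 𝔭bar (↑S)) →
        ∃ Q₂ : PowerSeries (PowerSeries (PadicComplexInt p)),
          (∃ u : (PowerSeries (PadicComplexInt p))ˣ,
              PowerSeries.constantCoeff Q₂ = (u : PowerSeries (PadicComplexInt p)) * Q) ∧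
          (XBig.charIdeal κ' (AnticyclotomicBigGaloisRep κ (Δ.cofreeRepOver K)) 𝔭bar (↑S)).map
              (PowerSeries.map (PowerSeries.map b)) ≤ Ideal.span {Q₂}) →
      Module.IsTorsion (PowerSeries (padicCoeffIntegers ιg)) (XBig κ (Δ.cofreeRepOver K) 𝔭bar (↑S)) →
      (XBig.charIdeal κ (Δ.cofreeRepOver K) 𝔭bar (↑S)).map (PowerSeries.map b) ≤ Ideal.span {Q} := by
  intro p _ M _ k g ιg Δ K _ _ 𝔭bar κ γ _ S hnf hk2 hke hpM hp3 hord hK hsplit h𝔭bar hirr hram hac hSp hSM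
    hHT b Q _ _ hpkg hT
  -- a cyclotomic `ℤ_p`-extension of the number field `K`, with a topological generator
  obtain ⟨κ', hκ'⟩ := Literature.NumberTheory.EllipticCurves.exists_cyclotomicZpExtension_holds K p
  obtain ⟨γ', hγ'⟩ := κ'.surjective (Multiplicative.ofAdd 1)
  haveI : Fact (κ'.IsTopGenerator γ') := ⟨hγ'⟩
  -- topologies on the two-variable Iwasawa algebra: any (the conclusion does not see them)
  letI : TopologicalSpace (PowerSeries (PowerSeries (padicCoeffIntegers ιg))) := ⊥
  haveI : DiscreteTopology (PowerSeries (PowerSeries (padicCoeffIntegers ιg))) := ⟨rfl⟩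
  obtain ⟨hfin, f, hf, hker⟩ := hControl g ιg Δ K 𝔭bar κ γ S hnf hk2 hke hpM hp3 hord hK hsplit h𝔭bar hirr
    hram hac hSp hSM hHT κ' γ' hκ'
  haveI := hfin
  exact AtData.map_charIdeal_le_span_of_twoVariable_of_control Δ 𝔭bar κ' κ S hnf b Q f hf hker
    (fun ht₂ ↦ by
      obtain ⟨Q₂, ⟨u, hu⟩, hle⟩ := hpkg κ' γ' hκ' ht₂
      exact ⟨Q₂, hle, u, hu⟩) hT

end OfControl

end Summit.BirchSwinnertonDyer.BirchSwinnertonDyer.Theorems.ErratumThm23TwoVariable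

end

/-! ## Build note (2026-08-28, cell `bsd-stepL`, seat `bsd-stepL-corner3-p2` g11)
Re-committed with every byte above this section unchanged, to re-queue the hub build of this module's olean (the build
job was lost after p611089; cell STATUS WANTED 2026-08-28T08:29:42Z: importers answered «stale:unbuilt»). No declaration
is added, removed or changed; nothing is asserted; BSD is not advanced by this note. -/

/-! ### Build-lane export guard (ops-buildfix bf1-g30, 2026-08-28; G11b-3 recipe v2 as in `GelbartRogawski1991/UnitaryDualPairSeesawCharacter`):
the theorems of this file carry very large dependent telescopes; at `.olean` export Lean 4.32's library-suggestion indexers fold over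
every local theorem statement and do not finish within the build lane's one-hour clock (measured on a farm node: `lean -o` > 1 500 s, plain
elaboration ≈ 20 s). ONE file-final `local` `[implicit_reducible]` keeps them out of that premise index (inert for Meta and the kernel on
theorems; no definition is tagged; statements and proofs unchanged). -/
set_option allowUnsafeReducibility true in
attribute [local implicit_reducible]

  _root_.Summit.BirchSwinnertonDyer.BirchSwinnertonDyer.Theorems.ErratumThm23TwoVariable.AtData.map_charIdeal_le_span_of_twoVariable_of_control
  _root_.Summit.BirchSwinnertonDyer.BirchSwinnertonDyer.Theorems.ErratumThm23TwoVariable.OfControl.stub_JSW_sigmaDescent_of_control
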